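import Literature.Probability.Percolation.ShorteningInfluenceBound
import Literature.Probability.Percolation.MooreShannonInfluenceBoundGeneral
import Literature.Probability.Percolation.KozmaNitzanSeparatingTriple
import Summits.CriticalPhenomena.PercolationContinuityZ3.Theorems.PercNearOneGluingNoHeavyLowerTailThreePointIsoSexticSureComponent
import HarnessLib

/-!
# The one-bond (pencil) identity for the super-terminal row `P3_λ`, and port–terminal pairs are free

Support file for crux `stmt-CriticalPhenomena-4575` (`NoHeavyLowerTail`), seat `prim-nh-lead-4575` lead gen 135
(`--supports stmt-CriticalPhenomena-4575`); memo `run/shared/lean/prim/prim-nh-lead-4575/FROM-prim-nh-lead-4575-g135-PENCIL-CRITERION.md`.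

Bond percolation `μ_w = prodBernoulli w` with arbitrary pair weights on a finite vertex type; terminals `s, a, b`, port `c`;
`F = {s ↔ a} ∩ {s ↮ b}`, `X = {c ↔ {s,a,b}}`; the row `P3_λ` is `μ(F)·μ(X) ≤ λ·μ(F ∩ X)` (`λ = 2` is the face row `P3½` of the lane,
`SuperTerminalPrimeReduction.p3half_of_primes`).  Write `E_λ(w) := λ·μ_w(F ∩ X) − μ_w(F)·μ_w(X)` for its slack.
* `pencil_identity` — for every pair `e` of weight `p = w e`, with `w⁰ = w[e ↦ 0]`, `w¹ = w[e ↦ 1]`: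
  `E_λ(w) = (1−p)·E_λ(w⁰) + p·E_λ(w¹) − p(1−p)·D·K`, `D = μ_{w⁰}(F) − μ_{w¹}(F)`, `K = μ_{w¹}(X) − μ_{w⁰}(X)` (every event probability is affine in
  `p`, `prodBernoulli_real_oneBond`).  Hence the PENCIL CRITERION `p3lam_of_pencil`: the row for `w⁰` and `w¹` plus `D·K ≤ 0 ∨ D·K ≤ E_λ(w⁰) + E_λ(w¹)`
  give the row for `w` (since `(1−p)E₀ + pE₁ − p(1−p)DK = (1−p)²E₀ + p²E₁ + p(1−p)(E₀ + E₁ − DK)`).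
* `p3lam_of_portPair_s/a/b` — **port–terminal pairs are free** for every `λ ≥ 2`: if the row holds for `w[s(c,t) ↦ 0]`, `t ∈ {s,a,b}`, it holds for `w`.
  (Opening `s(c,s)` destroys `F` only on `F ∩ {c ↔ b}` (`KNSep.reachable_insert_iff`), a subset of `F ∩ X`; and `X` is almost sure once `w(s(c,t)) = 1`.)
  So a counterexample to `P3½` with the fewest positive pairs has no positive pair between the port and a terminal.
No definitions, no sorries, standard axioms.
-/

namespace Summit.CriticalPhenomena.PercolationContinuityZ3.Theorems.SuperTerminalP3HalfPencil

open MeasureTheory Set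
open Literature.Probability.Percolation Literature.Probability.LatticeModels
open Summit.CriticalPhenomena.PercolationContinuityZ3.Theorems.ThreePointIsoSexticSureComponent
open scoped Classical

/-! ## Real algebra -/

section Real

/-- The pencil identity in real variables: with affine `g, f, k` along `p`,
`λ·g(p) − f(p)·k(p) = (1−p)·E₀ + p·E₁ − p(1−p)·(f₀−f₁)(k₁−k₀)`. [this work] -/
theorem pencil_identity_real (lam g0 g1 f0 f1 k0 k1 p : ℝ) :
    lam * ((1 - p) * g0 + p * g1) - ((1 - p) * f0 + p * f1) * ((1 - p) * k0 + p * k1) =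
      (1 - p) * (lam * g0 - f0 * k0) + p * (lam * g1 - f1 * k1) - p * (1 - p) * ((f0 - f1) * (k1 - k0)) := by
  ring

/-- **Pencil criterion (sufficient form).**  If `E₀, E₁ ≥ 0` and `D·K ≤ 0 ∨ D·K ≤ E₀ + E₁`, then
`(1−p)E₀ + pE₁ − p(1−p)·D·K ≥ 0` for every `p ∈ [0,1]`. [this work] -/
theorem pencil_criterion_real {E0 E1 DK p : ℝ} (hp0 : 0 ≤ p) (hp1 : p ≤ 1) (h0 : 0 ≤ E0) (h1 : 0 ≤ E1)
    (h : DK ≤ 0 ∨ DK ≤ E0 + E1) : 0 ≤ (1 - p) * E0 + p * E1 - p * (1 - p) * DK := by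
  have hpq : 0 ≤ p * (1 - p) := mul_nonneg hp0 (sub_nonneg.2 hp1)
  rcases h with h | h
  · nlinarith [mul_nonneg (sub_nonneg.2 hp1) h0, mul_nonneg hp0 h1, mul_nonneg hpq (neg_nonneg.2 h)]
  · have e1 : (1 - p) * E0 + p * E1 - p * (1 - p) * DK =
        (1 - p) ^ 2 * E0 + p ^ 2 * E1 + p * (1 - p) * (E0 + E1 - DK) := by ring
    rw [e1]
    nlinarith [mul_nonneg (sq_nonneg (1 - p)) h0, mul_nonneg (sq_nonneg p) h1, mul_nonneg hpq (sub_nonneg.2 h)]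

/-- **Pencil criterion (exact form at one point).**  For `0 < p < 1`: `D·K ≤ E₀/p + E₁/(1−p)` gives `(1−p)E₀ + pE₁ − p(1−p)DK ≥ 0`;
the weakest hypothesis over all `p` is `D·K ≤ (√E₀ + √E₁)²`. [this work] -/
theorem pencil_criterion_real_div {E0 E1 DK p : ℝ} (hp0 : 0 < p) (hp1 : p < 1) (h : DK ≤ E0 / p + E1 / (1 - p)) :
    0 ≤ (1 - p) * E0 + p * E1 - p * (1 - p) * DK := by
  have hq : 0 < 1 - p := sub_pos.2 hp1
  have e1 : p * (1 - p) * (E0 / p + E1 / (1 - p) - DK) = (1 - p) * E0 + p * E1 - p * (1 - p) * DK := by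
    have hp' : p ≠ 0 := hp0.ne'
    have hq' : 1 - p ≠ 0 := hq.ne'
    field_simp
  rw [← e1]
  exact mul_nonneg (mul_nonneg hp0.le hq.le) (sub_nonneg.2 h)

/-- The terminal-pair inequality in real variables (`λ ≥ 2`): from `E₀ = λg₀ − F₀k₀ ≥ 0`, `g₀ ≥ m`, `F₁ ≥ F₀ − m`, `k₀ ≤ 1`, `F₀ ≥ 0`, `m ≥ 0`:
`E₀ + (λ−1)F₁ ≥ (F₀ − F₁)(1 − k₀)`. [this work] -/
theorem terminal_pair_real {lam g0 F0 F1 k0 m : ℝ} (hlam : 2 ≤ lam) (hE0 : F0 * k0 ≤ lam * g0) (hgm : m ≤ g0) (hF1 : F0 - m ≤ F1)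
    (hk0 : 0 ≤ k0) (hk1 : k0 ≤ 1) (hF0 : 0 ≤ F0) (hm : 0 ≤ m) :
    (F0 - F1) * (1 - k0) ≤ (lam * g0 - F0 * k0) + (lam - 1) * F1 := by
  have hE0' := hE0
  nlinarith [hE0', mul_nonneg (sub_nonneg.2 hk1) hF0, mul_nonneg hm hk0,
    mul_nonneg (by linarith : (0:ℝ) ≤ lam - 1 + (1 - k0)) (by linarith : (0:ℝ) ≤ F1 - (F0 - m)),
    mul_nonneg (by linarith : (0:ℝ) ≤ lam) (sub_nonneg.2 hgm)]

end Real

/-! ## The pencil identity for `prodBernoulli` -/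

section Pencil

variable {V : Type*} [Fintype V]

/-- **Pencil identity.**  For every pair `e` (weight `p = w e`) and every `λ`, the slack `E_λ(w) = λ·μ_w(F∩X) − μ_w(F)·μ_w(X)` of the row `P3_λ`
satisfies `E_λ(w) = (1−p)·E_λ(w[e↦0]) + p·E_λ(w[e↦1]) − p(1−p)·(μ₀F − μ₁F)·(μ₁X − μ₀X)` (stated for arbitrary events `F, X`, `FX`; used with
`FX = F ∩ X`). [this work] -/
theorem pencil_identity (w : Sym2 V → unitInterval) (e : Sym2 V) (lam : ℝ) (F X FX : Set (BondConfig V)) :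
    lam * (prodBernoulli w).real FX - (prodBernoulli w).real F * (prodBernoulli w).real X =
      (1 - (w e : ℝ)) * (lam * (prodBernoulli (Function.update w e 0)).real FX -
          (prodBernoulli (Function.update w e 0)).real F * (prodBernoulli (Function.update w e 0)).real X) +
        (w e : ℝ) * (lam * (prodBernoulli (Function.update w e 1)).real FX -
          (prodBernoulli (Function.update w e 1)).real F * (prodBernoulli (Function.update w e 1)).real X) -
        (w e : ℝ) * (1 - (w e : ℝ)) *
          (((prodBernoulli (Function.update w e 0)).real F - (prodBernoulli (Function.update w e 1)).real F) *
            ((prodBernoulli (Function.update w e 1)).real X - (prodBernoulli (Function.update w e 0)).real X)) := by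
  rw [prodBernoulli_real_oneBond (determinedBy_coe_univ FX) w (Finset.mem_univ e),
    prodBernoulli_real_oneBond (determinedBy_coe_univ F) w (Finset.mem_univ e),
    prodBernoulli_real_oneBond (determinedBy_coe_univ X) w (Finset.mem_univ e)]
  ring

/-- **Pencil criterion for `P3_λ`.**  If the row holds for `w[e↦0]` and `w[e↦1]` and the convexity defect `D·K` (`D = μ₀F − μ₁F`, `K = μ₁X − μ₀X`)
is either `≤ 0` or at most the sum of the two endpoint slacks, then the row holds for `w`. [this work] -/
theorem p3lam_of_pencil (w : Sym2 V → unitInterval) (e : Sym2 V) (lam : ℝ) (F X : Set (BondConfig V))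
    (h0 : (prodBernoulli (Function.update w e 0)).real F * (prodBernoulli (Function.update w e 0)).real X ≤
      lam * (prodBernoulli (Function.update w e 0)).real (F ∩ X))
    (h1 : (prodBernoulli (Function.update w e 1)).real F * (prodBernoulli (Function.update w e 1)).real X ≤
      lam * (prodBernoulli (Function.update w e 1)).real (F ∩ X))
    (hDK : ((prodBernoulli (Function.update w e 0)).real F - (prodBernoulli (Function.update w e 1)).real F) *
        ((prodBernoulli (Function.update w e 1)).real X - (prodBernoulli (Function.update w e 0)).real X) ≤ 0 ∨
      ((prodBernoulli (Function.update w e 0)).real F - (prodBernoulli (Function.update w e 1)).real F) *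
        ((prodBernoulli (Function.update w e 1)).real X - (prodBernoulli (Function.update w e 0)).real X) ≤
      (lam * (prodBernoulli (Function.update w e 0)).real (F ∩ X) -
          (prodBernoulli (Function.update w e 0)).real F * (prodBernoulli (Function.update w e 0)).real X) +
        (lam * (prodBernoulli (Function.update w e 1)).real (F ∩ X) -
          (prodBernoulli (Function.update w e 1)).real F * (prodBernoulli (Function.update w e 1)).real X)) :
    (prodBernoulli w).real F * (prodBernoulli w).real X ≤ lam * (prodBernoulli w).real (F ∩ X) := by
  have hid := pencil_identity w e lam F X (F ∩ X)
  have hp0 : (0 : ℝ) ≤ w e := (w e).2.1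
  have hp1 : (w e : ℝ) ≤ 1 := (w e).2.2
  have key := pencil_criterion_real hp0 hp1 (sub_nonneg.2 h0) (sub_nonneg.2 h1) hDK
  linarith [key, hid]

end Pencil

/-! ## Port–terminal pairs are free -/

section Terminal

variable {V : Type*} [Fintype V]

/-- If `w e = 1` for `e = s(c,t)` then `c ↔ t` almost surely, so every event containing `openConn c t` has probability `1`. [folklore] -/
theorem real_eq_one_of_update_one (w : Sym2 V → unitInterval) (c t : V) (X : Set (BondConfig V))
    (hX : (openConn c t : Set (BondConfig V)) ⊆ X) :
    (prodBernoulli (Function.update w s(c, t) 1)).real X = 1 := by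
  have h1 : (prodBernoulli (Function.update w s(c, t) 1)).real (openConn c t) = 1 := by
    by_cases hct : c = t
    · subst hct
      have : (openConn c c : Set (BondConfig V)) = univ := eq_univ_of_forall fun ω => SimpleGraph.Reachable.refl _
      rw [this]; exact probReal_univ
    · refine real_openConn_eq_one_of_sure (Function.update w s(c, t) 1) (SimpleGraph.Adj.reachable ?_)
      rw [openGraph_adj]
      exact ⟨by simp, hct⟩
  apply le_antisymm
  · exact (measureReal_mono (subset_univ _)).trans (by simp)
  · rw [← h1]; exact measureReal_mono hX

/-- With `X` almost sure under `w[e↦1]`, `μ₁(F ∩ X) = μ₁(F)`. [folklore] -/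
theorem real_inter_eq_of_update_one (w : Sym2 V → unitInterval) (c t : V) (F X : Set (BondConfig V))
    (hX : (openConn c t : Set (BondConfig V)) ⊆ X) :
    (prodBernoulli (Function.update w s(c, t) 1)).real (F ∩ X) = (prodBernoulli (Function.update w s(c, t) 1)).real F := by
  set μ1 := prodBernoulli (Function.update w s(c, t) 1) with hμ1
  have hXc : μ1.real Xᶜ = 0 := by
    rw [probReal_compl_eq_one_sub MeasurableSet.of_discrete, real_eq_one_of_update_one w c t X hX, sub_self]
  have hsplit : μ1.real (F ∩ X) + μ1.real (F \ X) = μ1.real F := measureReal_inter_add_sdiff MeasurableSet.of_discrete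
  have hz : μ1.real (F \ X) = 0 :=
    le_antisymm ((measureReal_mono (fun ω hω => hω.2 : F \ X ⊆ Xᶜ)).trans hXc.le) measureReal_nonneg
  linarith

/-- Shorthand used only in this section's statements: the slack form of the row is spelled out in full in each theorem. -/
theorem p3lam_of_portPair_aux (w : Sym2 V → unitInterval) (c t u : V) {lam : ℝ} (hlam : 2 ≤ lam)
    (F X : Set (BondConfig V)) (hXt : (openConn c t : Set (BondConfig V)) ⊆ X) (hXu : (openConn c u : Set (BondConfig V)) ⊆ X)
    (hins : F ∩ (openConn c u)ᶜ ⊆ {ω : BondConfig V | insert s(c, t) ω ∈ F})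
    (h0 : (prodBernoulli (Function.update w s(c, t) 0)).real F * (prodBernoulli (Function.update w s(c, t) 0)).real X ≤
      lam * (prodBernoulli (Function.update w s(c, t) 0)).real (F ∩ X)) :
    (prodBernoulli w).real F * (prodBernoulli w).real X ≤ lam * (prodBernoulli w).real (F ∩ X) := by
  set e : Sym2 V := s(c, t) with he
  set μ0 := prodBernoulli (Function.update w e 0) with hμ0
  set μ1 := prodBernoulli (Function.update w e 1) with hμ1
  -- the `e`-open endpoint in terms of `μ0`
  have hupd : ∀ A : Set (BondConfig V), μ1.real A = μ0.real {ω | insert e ω ∈ A} := fun A => by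
    rw [hμ1, hμ0, ← prodBernoulli_real_update_one_eq (determinedBy_coe_univ A) (Function.update w e 0) (Finset.mem_univ e),
      Function.update_idem]
  have k1 : μ1.real X = 1 := real_eq_one_of_update_one w c t X hXt
  have g1 : μ1.real (F ∩ X) = μ1.real F := real_inter_eq_of_update_one w c t F X hXt
  -- `F₁ ≥ F₀ − m`, `g₀ ≥ m` with `m = μ₀(F ∩ {c ↔ u})`
  have hsplit : μ0.real (F ∩ openConn c u) + μ0.real (F \ openConn c u) = μ0.real F :=
    measureReal_inter_add_sdiff MeasurableSet.of_discrete
  have hF1 : μ0.real F - μ0.real (F ∩ openConn c u) ≤ μ1.real F := by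
    rw [hupd F]
    have : μ0.real (F \ openConn c u) ≤ μ0.real {ω | insert e ω ∈ F} := measureReal_mono (fun ω hω => hins ⟨hω.1, hω.2⟩)
    linarith
  have hgm : μ0.real (F ∩ openConn c u) ≤ μ0.real (F ∩ X) := measureReal_mono (inter_subset_inter_right _ hXu)
  have hk0 : μ0.real X ≤ 1 := (measureReal_mono (subset_univ _)).trans (by simp)
  have key := terminal_pair_real hlam h0 hgm hF1 measureReal_nonneg hk0 measureReal_nonneg measureReal_nonneg
  refine p3lam_of_pencil w e lam F X h0 ?_ (Or.inr ?_)
  · rw [g1, k1]; nlinarith [(measureReal_nonneg : 0 ≤ μ1.real F)]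
  · rw [g1, k1]; linarith [key]

/-- **The port–`s` pair is free** (`λ ≥ 2`): if the row `μ(F)μ(X) ≤ λ μ(F∩X)` holds after deleting the pair `s(c,s)`, it holds for `w`. [this work] -/
theorem p3lam_of_portPair_s (w : Sym2 V → unitInterval) (s a b c : V) {lam : ℝ} (hlam : 2 ≤ lam)
    (h0 : (prodBernoulli (Function.update w s(c, s) 0)).real (openConn s a ∩ (openConn s b)ᶜ) *
        (prodBernoulli (Function.update w s(c, s) 0)).real ((openConn c s)ᶜ ∩ (openConn c a)ᶜ ∩ (openConn c b)ᶜ)ᶜ ≤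
      lam * (prodBernoulli (Function.update w s(c, s) 0)).real
        (openConn s a ∩ (openConn s b)ᶜ ∩ ((openConn c s)ᶜ ∩ (openConn c a)ᶜ ∩ (openConn c b)ᶜ)ᶜ)) :
    (prodBernoulli w).real (openConn s a ∩ (openConn s b)ᶜ) *
        (prodBernoulli w).real ((openConn c s)ᶜ ∩ (openConn c a)ᶜ ∩ (openConn c b)ᶜ)ᶜ ≤
      lam * (prodBernoulli w).real (openConn s a ∩ (openConn s b)ᶜ ∩ ((openConn c s)ᶜ ∩ (openConn c a)ᶜ ∩ (openConn c b)ᶜ)ᶜ) := by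
  refine p3lam_of_portPair_aux w c s b hlam _ _ (fun ω hω hn => hn.1.1 hω) (fun ω hω hn => hn.2 hω) ?_ h0
  · rintro ω ⟨⟨hsa, hsb⟩, hcb⟩
    simp only [mem_setOf_eq, mem_inter_iff, mem_compl_iff, openConn] at hsa hsb hcb ⊢
    refine ⟨hsa.mono (openGraph_mono (subset_insert _ _)), ?_⟩
    rw [KNSep.reachable_insert_iff]
    rintro (h | ⟨-, h⟩ | ⟨-, h⟩)
    · exact hsb h
    · exact hsb h
    · exact hcb h

/-- **The port–`a` pair is free** (`λ ≥ 2`). [this work] -/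
theorem p3lam_of_portPair_a (w : Sym2 V → unitInterval) (s a b c : V) {lam : ℝ} (hlam : 2 ≤ lam)
    (h0 : (prodBernoulli (Function.update w s(c, a) 0)).real (openConn s a ∩ (openConn s b)ᶜ) *
        (prodBernoulli (Function.update w s(c, a) 0)).real ((openConn c s)ᶜ ∩ (openConn c a)ᶜ ∩ (openConn c b)ᶜ)ᶜ ≤
      lam * (prodBernoulli (Function.update w s(c, a) 0)).real
        (openConn s a ∩ (openConn s b)ᶜ ∩ ((openConn c s)ᶜ ∩ (openConn c a)ᶜ ∩ (openConn c b)ᶜ)ᶜ)) :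
    (prodBernoulli w).real (openConn s a ∩ (openConn s b)ᶜ) *
        (prodBernoulli w).real ((openConn c s)ᶜ ∩ (openConn c a)ᶜ ∩ (openConn c b)ᶜ)ᶜ ≤
      lam * (prodBernoulli w).real (openConn s a ∩ (openConn s b)ᶜ ∩ ((openConn c s)ᶜ ∩ (openConn c a)ᶜ ∩ (openConn c b)ᶜ)ᶜ) := by
  refine p3lam_of_portPair_aux w c a b hlam _ _ (fun ω hω hn => hn.1.2 hω) (fun ω hω hn => hn.2 hω) ?_ h0
  · rintro ω ⟨⟨hsa, hsb⟩, hcb⟩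
    simp only [mem_setOf_eq, mem_inter_iff, mem_compl_iff, openConn] at hsa hsb hcb ⊢
    refine ⟨hsa.mono (openGraph_mono (subset_insert _ _)), ?_⟩
    rw [KNSep.reachable_insert_iff]
    rintro (h | ⟨-, h⟩ | ⟨-, h⟩)
    · exact hsb h
    · exact hsb (hsa.trans h)
    · exact hcb h

/-- **The port–`b` pair is free** (`λ ≥ 2`). [this work] -/
theorem p3lam_of_portPair_b (w : Sym2 V → unitInterval) (s a b c : V) {lam : ℝ} (hlam : 2 ≤ lam)
    (h0 : (prodBernoulli (Function.update w s(c, b) 0)).real (openConn s a ∩ (openConn s b)ᶜ) *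
        (prodBernoulli (Function.update w s(c, b) 0)).real ((openConn c s)ᶜ ∩ (openConn c a)ᶜ ∩ (openConn c b)ᶜ)ᶜ ≤
      lam * (prodBernoulli (Function.update w s(c, b) 0)).real
        (openConn s a ∩ (openConn s b)ᶜ ∩ ((openConn c s)ᶜ ∩ (openConn c a)ᶜ ∩ (openConn c b)ᶜ)ᶜ)) :
    (prodBernoulli w).real (openConn s a ∩ (openConn s b)ᶜ) *
        (prodBernoulli w).real ((openConn c s)ᶜ ∩ (openConn c a)ᶜ ∩ (openConn c b)ᶜ)ᶜ ≤
      lam * (prodBernoulli w).real (openConn s a ∩ (openConn s b)ᶜ ∩ ((openConn c s)ᶜ ∩ (openConn c a)ᶜ ∩ (openConn c b)ᶜ)ᶜ) := by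
  refine p3lam_of_portPair_aux w c b s hlam _ _ (fun ω hω hn => hn.2 hω) (fun ω hω hn => hn.1.1 hω) ?_ h0
  · rintro ω ⟨⟨hsa, hsb⟩, hcs⟩
    simp only [mem_setOf_eq, mem_inter_iff, mem_compl_iff, openConn] at hsa hsb hcs ⊢
    refine ⟨hsa.mono (openGraph_mono (subset_insert _ _)), ?_⟩
    rw [KNSep.reachable_insert_iff]
    rintro (h | ⟨h, -⟩ | ⟨h, -⟩)
    · exact hsb h
    · exact hcs h.symm
    · exact hsb h

/-- **`P3½`: port–terminal pairs are free.**  The face row `μ(F)·μ(c↔T) ≤ 2·μ(F ∩ c↔T)` for `w` follows from the row for the weight with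
the three pairs `s(c,s), s(c,a), s(c,b)` deleted. Hence a counterexample to `P3½` with the fewest positive pairs has its port adjacent to no
terminal. [this work] -/
theorem p3half_of_portTerminalPairs (w : Sym2 V → unitInterval) (s a b c : V)
    (h0 : let w' := Function.update (Function.update (Function.update w s(c, s) 0) s(c, a) 0) s(c, b) 0
      (prodBernoulli w').real (openConn s a ∩ (openConn s b)ᶜ) *
        (prodBernoulli w').real ((openConn c s)ᶜ ∩ (openConn c a)ᶜ ∩ (openConn c b)ᶜ)ᶜ ≤
      2 * (prodBernoulli w').real (openConn s a ∩ (openConn s b)ᶜ ∩ ((openConn c s)ᶜ ∩ (openConn c a)ᶜ ∩ (openConn c b)ᶜ)ᶜ)) :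
    (prodBernoulli w).real (openConn s a ∩ (openConn s b)ᶜ) *
        (prodBernoulli w).real ((openConn c s)ᶜ ∩ (openConn c a)ᶜ ∩ (openConn c b)ᶜ)ᶜ ≤
      2 * (prodBernoulli w).real (openConn s a ∩ (openConn s b)ᶜ ∩ ((openConn c s)ᶜ ∩ (openConn c a)ᶜ ∩ (openConn c b)ᶜ)ᶜ) := by
  have two : (2 : ℝ) ≤ 2 := le_rfl
  refine p3lam_of_portPair_s w s a b c two ?_
  refine p3lam_of_portPair_a (Function.update w s(c, s) 0) s a b c two ?_
  exact p3lam_of_portPair_b (Function.update (Function.update w s(c, s) 0) s(c, a) 0) s a b c two h0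

end Terminal

end Summit.CriticalPhenomena.PercolationContinuityZ3.Theorems.SuperTerminalP3HalfPencil
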